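import Summits.PneNP.PneNP.Theses.Circuit2
import Literature.Computability.Complexity.EasyWitnessSearch

/-!
# Refutation of `Circuit2.CircuitMagnificationFrontier` (stmt-PneNP-0265) [refuted-misstated]

The crux asks for a size function `s` (time-constructible, `log s = o(n)`) with, for every `c`,
`MCSP[s] ∉ STREAM (N ↦ s(⌊log₂ N⌋)^c + c) (same)`; `STREAM S T` (Magnification.lean) is the class
of languages decided by a ONE-PASS STREAMING ALGORITHM (per input length `N`: arbitrary initial
state, update map and accepting predicate on bit-string states) of SPACE `S` (states of length
`≤ S N`) and UPDATE TIME `T` (`HasUpdateTime`: for each `N` SOME Mathlib `TM2` machine computes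
`⟨st, b⟩ ↦ update N st b` within `T N` steps on states of length `≤ S N`).
We prove the negation: for EVERY `s` with `s n ≥ n` (half of `IsTimeConstructible`; neither its
computability half nor `log s = o(n)` is used), `MCSP[s] ∈ STREAM (N ↦ s(⌊log₂N⌋)^60 + 60) (same)`.
Two artefacts of the Lean rendering combine (steps 1–2 and step 3 of the proof):
1. **Update time is vacuous**: the machine may depend on `N`, its finite control is an arbitrary
   `Fintype`, and ONE Mathlib `TM2.step` runs a whole `Stmt` tree, so every map on words of
   length `≤ B` is computed by a one-stack `FinTM2` (states = words of length `≤ B`: pop the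
   input into the state, push the image, reset, halt) in ONE step; hence
   `HasSpace S → (∀ N, 1 ≤ T N) → HasUpdateTime S T` for every streaming algorithm.
2. **Space alone is no obstruction** (McKay–Murray–Williams, STOC 2019, §1: "no
   information-theoretic barrier"): with arbitrary (non-uniform, uncomputable) update maps the
   state after a prefix `p` of an arity-`n` table is `0 · bin_{n+1}(|p|) · desc C` for SOME
   `B₂`-circuit `C` of size `≤ s n` whose table extends `p` (dead prefixes ↦ `[1]`); the prefix is
   recovered from the state through the table of the description (`EasyWitness.ttOf_desc`), so
   the update is well defined, the final state is live iff the input is the table of a small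
   circuit (`exists_computes_B2_size_eq_holds`), and the state length `n + 2 + (s+1)(8(n+s)+10)`
   (`Kannan.length_desc_le_of_size_le`) is `≤ s^60 + 60` for `n ≤ s`.
Classification `refuted-misstated`: the witness exploits the permissive per-`N` one-step machine
model of `HasUpdateTime` (flagged in the planner's retriage note), not the mechanism. Repaired
statement C′ (McKay–Murray–Williams 2019, Thm. 1.3/1.4): EITHER the uniform streaming form — ONE
machine for all `N`, `poly(s)` space AND `poly(s)` update time (needs a new definition: `∃ M, ∀ N`,
size-independent finite control) — OR the circuit form expressible today (Thm. 1.4, third bullet,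
decision/size-only strengthening), `∃ s, IsTimeConstructible s ∧
(fun n => Real.log (s n)) =o[atTop] (fun n => (n : ℝ)) ∧ ∀ c, MCSPSize s ∉
SIZE (fun N => N * s (Nat.log 2 N) ^ c + c)`. The witness bites neither (no uniform machine: its
update solves a circuit-consistency search and its control grows with `N`; no circuit bound).
-/

namespace Summit.PneNP.PneNP.Theses.Circuit2

open scoped BigOperators Topology Manifold Classical MeasureTheory ProbabilityTheory Matrix InnerProductSpace ComplexConjugate ContinuousMap
open Filter Set Function TopologicalSpace MeasureTheory

/-- **Record of the replaced/dropped route item `CircuitMagnificationFrontier`** = stmt-PneNP-0265 (ledger signature verbatim, in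
the route file's namespace and `open` context; NOT a route item): after `Circuit2CircuitMagnificationFrontier_refuted` (below) closed the
item `refuted` at 4bec25c2c3a7, the route repair (`restate` under a new name, or `drop`) removed
this constant from the gate-written Theses file, while the Theorems file below — append-only,
statement text fixed — still names it ("Unknown identifier" in the full builds of 2026-08-16).
Re-declared here under its original fully-qualified name and definiens solely so that this record
keeps elaborating. FALSE (refuted below). -/
def CircuitMagnificationFrontier : Prop :=
  ∃ s : ℕ → ℕ, Literature.Computability.Complexity.IsTimeConstructible s ∧ Asymptotics.IsLittleO Filter.atTop (fun n : ℕ => Real.log (s n)) (fun n : ℕ => (n : ℝ)) ∧ ∀ c : ℕ, Literature.Computability.MetaComplexity.MCSPSize s ∉ Literature.Computability.MetaComplexity.STREAM (fun N : ℕ => s (Nat.log 2 N) ^ c + c) (fun N : ℕ => s (Nat.log 2 N) ^ c + c)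

end Summit.PneNP.PneNP.Theses.Circuit2

open Turing
open Literature.Computability.Complexity Literature.Computability.MetaComplexity

namespace Summit.PneNP.PneNP.Theorems

open Classical in
/-- Refutes `Circuit2.CircuitMagnificationFrontier` [refuted-misstated]: the statement wants SOME
`s` (time-constructible, `log s = o(n)`) with `MCSP[s] ∉ STREAM (N ↦ s(⌊log₂N⌋)^c + c) (same)` for
ALL `c`, but for EVERY `s` with `s n ≥ n`, `MCSP[s] ∈ STREAM (N ↦ s(⌊log₂N⌋)^60 + 60) (same)`:
update time is vacuous in the per-`N` one-step `TM2` model (steps 1–2) and a non-uniform update map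
keeps `(|prefix|, desc C)` for a small circuit `C` consistent with the prefix (step 3); witness
`c = 60`. Repaired statement C′: the uniform streaming form (one machine for all `N`, poly(s) space
and update time; needs a new definition) or the circuit form `∃ s, IsTimeConstructible s ∧
log s = o(n) ∧ ∀ c, MCSPSize s ∉ SIZE (fun N => N * s (Nat.log 2 N) ^ c + c)`
(McKay–Murray–Williams 2019, Thm. 1.3/1.4); the witness misses both. [folklore] -/
theorem Circuit2CircuitMagnificationFrontier_refuted :
    ¬ Summit.PneNP.PneNP.Theses.Circuit2.CircuitMagnificationFrontier := by
  /- STEP 1. One-step machines: every map `out` on words of length `≤ B` (values of length `≤ B'`)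
     is computed by some `TM2` machine in ONE step. -/
  have oneStep : ∀ (B B' : ℕ) (out : List Bool → List Bool), (∀ w, (out w).length ≤ B') →
      ∃ M : TM2ComputableAux Bool Bool,
        ∀ w : List Bool, w.length ≤ B → M.OutputsWithin w (out w) 1 := by
    intro B B' out hout
    haveI : Fintype {l : List Bool // l.length ≤ B} :=
      haveI : Finite {l : List Bool // l.length ≤ B} := (List.finite_length_le Bool B).to_subtype
      Fintype.ofFinite _
    -- appending a popped symbol to the state (if any, and if there is room)
    obtain ⟨snoc, hsn, hss⟩ : ∃ snoc : {l : List Bool // l.length ≤ B} → Option Bool →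
        {l : List Bool // l.length ≤ B}, (∀ v, snoc v none = v) ∧
          ∀ v b, (snoc v (some b)).1 = if v.1.length < B then v.1 ++ [b] else v.1 :=
      ⟨fun v o => match o with
        | none => v
        | some b =>
          if h : v.1.length < B then ⟨v.1 ++ [b], by simpa using Nat.succ_le_of_lt h⟩ else v,
       fun _ => rfl, fun v b => by dsimp only; split_ifs <;> rfl⟩
    -- absorbing a word that fits appends it to the state
    have habsorb : ∀ (l : List Bool) (v : {l : List Bool // l.length ≤ B}),
        v.1.length + l.length ≤ B → (l.foldl (fun v b => snoc v (some b)) v).1 = v.1 ++ l := by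
      intro l
      induction l with
      | nil => intro v _; simp
      | cons a l ih =>
        intro v h
        have hlt : v.1.length < B := by simp at h; omega
        have h1 : (snoc v (some a)).1 = v.1 ++ [a] := by rw [hss, if_pos hlt]
        rw [List.foldl_cons, ih _ (by rw [h1]; simp at h ⊢; omega), h1, List.append_assoc,
          List.singleton_append]
    -- the pop phase `P q j`: pop `j` symbols into the state, then continue with `q`
    obtain ⟨P, hP0, hPS⟩ : ∃ P :
        TM2.Stmt (fun _ : Unit => Bool) Unit {l : List Bool // l.length ≤ B} →
          ℕ → TM2.Stmt (fun _ : Unit => Bool) Unit {l : List Bool // l.length ≤ B},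
        (∀ q, P q 0 = q) ∧ ∀ q j, P q (j + 1) = TM2.Stmt.pop () snoc (P q j) :=
      ⟨fun q j => (TM2.Stmt.pop () snoc)^[j] q, fun _ => rfl,
        fun q j => Function.iterate_succ_apply' _ _ _⟩
    have hP : ∀ (q : TM2.Stmt (fun _ : Unit => Bool) Unit {l : List Bool // l.length ≤ B}) (j : ℕ)
        (v : {l : List Bool // l.length ≤ B}) (S : ∀ _ : Unit, List Bool),
        TM2.stepAux (P q j) v S =
          TM2.stepAux q (((S ()).take j).foldl (fun v b => snoc v (some b)) v)
            (Function.update S () ((S ()).drop j)) := by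
      intro q j
      induction j with
      | zero => intro v S; simp [hP0]
      | succ j ih =>
        intro v S
        rw [hPS, TM2.stepAux, ih]
        cases hS : S () with
        | nil => simp [hsn]
        | cons a t => simp
    -- the push phase `Q q j`: push `(out state).take j` in reverse, then continue with `q`
    obtain ⟨Q, hQ0, hQS⟩ : ∃ Q :
        TM2.Stmt (fun _ : Unit => Bool) Unit {l : List Bool // l.length ≤ B} →
          ℕ → TM2.Stmt (fun _ : Unit => Bool) Unit {l : List Bool // l.length ≤ B},
        (∀ q, Q q 0 = q) ∧ ∀ q j, Q q (j + 1) =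
          TM2.Stmt.branch (fun v => decide (j < (out v.1).length))
            (TM2.Stmt.push () (fun v => (out v.1).getD j false) (Q q j)) (Q q j) :=
      ⟨fun q j => Nat.rec (motive := fun _ => TM2.Stmt (fun _ : Unit => Bool) Unit
          {l : List Bool // l.length ≤ B}) q (fun j r =>
          TM2.Stmt.branch (fun v => decide (j < (out v.1).length))
            (TM2.Stmt.push () (fun v => (out v.1).getD j false) r) r) j,
        fun _ => rfl, fun _ _ => rfl⟩
    have hQ : ∀ (q : TM2.Stmt (fun _ : Unit => Bool) Unit {l : List Bool // l.length ≤ B}) (j : ℕ)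
        (v : {l : List Bool // l.length ≤ B}) (S : ∀ _ : Unit, List Bool),
        TM2.stepAux (Q q j) v S =
          TM2.stepAux q v (Function.update S () ((out v.1).take j ++ S ())) := by
      intro q j
      induction j with
      | zero => intro v S; simp [hQ0]
      | succ j ih =>
        intro v S
        by_cases hj : j < (out v.1).length
        · rw [hQS]
          simp only [TM2.stepAux, hj, decide_true, cond_true, ih]
          rw [Function.update_idem, Function.update_self, List.take_succ_eq_append_getElem hj,
            List.getD_eq_getElem _ _ hj, List.append_assoc, List.singleton_append]
        · rw [hQS]
          simp only [TM2.stepAux, hj, decide_false, cond_false, ih]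
          push Not at hj
          rw [List.take_of_length_le hj, List.take_of_length_le (by omega)]
    -- the machine: pop `B` symbols, push the image, reset the state, halt — all in one step
    refine ⟨⟨
      { K := Unit
        k₀ := ()
        k₁ := ()
        Γ := fun _ => Bool
        Λ := Unit
        main := ()
        σ := {l : List Bool // l.length ≤ B}
        initialState := ⟨[], by simp⟩
        m := fun _ => P (Q (TM2.Stmt.load (fun _ => ⟨[], by simp⟩) TM2.Stmt.halt) B') B },
      Equiv.refl Bool, Equiv.refl Bool⟩, fun w hw => ⟨⟨⟨1, ?_⟩, le_rfl⟩⟩⟩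
    have habs : ((w.take B).foldl (fun v b => snoc v (some b)) ⟨[], by simp⟩).1 = w := by
      rw [habsorb] <;> simp [List.take_of_length_le hw]; exact hw
    simp only [Equiv.refl_symm, Equiv.coe_refl, List.map_id, Option.map_some]
    show some (TM2.stepAux (P (Q (TM2.Stmt.load (fun _ => ⟨[], by simp⟩) TM2.Stmt.halt) B') B)
      ⟨[], by simp⟩ (fun _ => w)) =
      some ⟨none, ⟨[], by simp⟩, fun _ => out w⟩
    rw [hP, hQ]
    simp only [TM2.stepAux]
    congr 2
    funext k
    simp [List.drop_of_length_le hw, habs, List.take_of_length_le (hout _)]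
  /- STEP 2. Update time is vacuous: space `S` alone gives update time `T` whenever `T ≥ 1`. -/
  have updFree : ∀ (A : StreamingAlgorithm) (S T : ℕ → ℕ), A.HasSpace S → (∀ N, 1 ≤ T N) →
      A.HasUpdateTime S T := by
    intro A S T hS hT N
    obtain ⟨M, hM⟩ := oneStep (2 * S N + 3) (S N)
      (fun w => if ((boolUnpair w).1).length ≤ S N then
        A.update N (boolUnpair w).1 (((boolUnpair w).2).headD false) else [])
      (fun w => by split_ifs with h <;> [exact (hS N).2 _ _ h; simp])
    refine ⟨M, fun st b hst => ?_⟩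
    have h := hM (boolPair st [b]) (by rw [length_boolPair, List.length_singleton]; omega)
    simp only [boolUnpair_boolPair] at h
    rw [if_pos hst] at h
    exact h.mono (hT N)
  /- STEP 3. For every `s` with `s n ≥ n`: a one-pass streaming algorithm for `MCSP[s]` of space
     `s(⌊log₂ N⌋)^60 + 60` (non-uniform, uncomputable update maps are allowed by the model). -/
  rintro ⟨s, ⟨hs, -⟩, -, hno⟩
  -- good tables at arity `n`: truth tables of `B₂`-circuits of size `≤ s n`
  obtain ⟨G, hG⟩ : ∃ G : ℕ → Set (List Bool), ∀ n x, x ∈ G n ↔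
      ∃ C : Circuit (Fin n), C.IsOver B2 ∧ C.size ≤ s n ∧ x = truthTable C.eval :=
    ⟨fun n => {x | ∃ C : Circuit (Fin n), C.IsOver B2 ∧ C.size ≤ s n ∧ x = truthTable C.eval},
      fun _ _ => Iff.rfl⟩
  have hGmem : ∀ {n : ℕ} {x : List Bool}, x ∈ G n ↔ x ∈ MCSPSize s ∧ x.length = 2 ^ n := by
    intro n x
    rw [hG]
    constructor
    · rintro ⟨C, hCo, hCs, rfl⟩
      refine ⟨⟨n, C.eval, rfl, ?_⟩, length_truthTable _⟩
      exact (circuitSizeOver_le_of_computes C hCo (fun _ => rfl)).trans hCs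
    · rintro ⟨⟨m, f, rfl, hf⟩, hlen⟩
      rw [length_truthTable] at hlen
      obtain rfl : m = n := Nat.pow_right_injective le_rfl hlen
      obtain ⟨C, hCo, hCf, hCsz⟩ := exists_computes_B2_size_eq_holds f
      refine ⟨C, hCo, by rw [hCsz]; exact hf, ?_⟩
      rw [show C.eval = f from funext hCf]
  -- the state of a prefix `p`: `[1]` if dead, else `0 · bin_{n+1}(|p|) · desc C` for SOME small
  -- circuit `C` whose table extends `p`; decoding through the table of the description
  obtain ⟨enc, henc⟩ : ∃ enc : ℕ → List Bool → List Bool, ∀ n p, enc n p =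
      if h : ∃ x ∈ G n, p <+: x then
        false :: (Kannan.bitsOf (n + 1) p.length ++
          CircEval.desc (Classical.choose ((hG n _).1 (Classical.choose_spec h).1)))
      else [true] := ⟨_, fun _ _ => rfl⟩
  obtain ⟨dec, hdec⟩ : ∃ dec : ℕ → List Bool → List Bool, ∀ n rest, dec n (false :: rest) =
      (EasyWitness.ttOf n (rest.drop (n + 1))).take (bitsToNat (rest.take (n + 1))) :=
    ⟨fun n st => match st with
      | false :: rest =>
        (EasyWitness.ttOf n (rest.drop (n + 1))).take (bitsToNat (rest.take (n + 1)))
      | _ => [], fun _ _ => rfl⟩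
  have henc0 : ∀ {n : ℕ} {p : List Bool}, (¬ ∃ x ∈ G n, p <+: x) → enc n p = [true] :=
    fun h => by rw [henc, dif_neg h]
  have henc1 : ∀ {n : ℕ} {p : List Bool}, (∃ x ∈ G n, p <+: x) → enc n p ≠ [true] :=
    fun h => by rw [henc, dif_pos h]; simp
  have hdecenc : ∀ {n : ℕ} {p : List Bool}, (∃ x ∈ G n, p <+: x) → dec n (enc n p) = p := by
    intro n p h
    rw [henc, dif_pos h, hdec]
    obtain ⟨hgood, hpx⟩ := Classical.choose_spec h
    obtain ⟨hCo, -, hCx⟩ := Classical.choose_spec ((hG n _).1 (Classical.choose_spec h).1)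
    have hlen : (Classical.choose h).length = 2 ^ n := (hGmem.1 hgood).2
    have hlt : p.length < 2 ^ (n + 1) := by
      have h2 : 2 ^ n < 2 ^ (n + 1) := Nat.pow_lt_pow_right (by norm_num) (by omega)
      have := hpx.length_le; omega
    rw [List.take_left' (Kannan.length_bitsOf _ _), List.drop_left' (Kannan.length_bitsOf _ _),
      Kannan.bitsToNat_bitsOf _ _ hlt, EasyWitness.ttOf_desc _ hCo, ← hCx]
    exact (List.prefix_iff_eq_take.1 hpx).symm
  -- the update map and its action on states of prefixes
  obtain ⟨upd, hupd⟩ : ∃ upd : ℕ → List Bool → Bool → List Bool, ∀ n st b,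
      upd n st b = if st = [true] then [true] else enc n (dec n st ++ [b]) :=
    ⟨_, fun _ _ _ => rfl⟩
  have hupdenc : ∀ (n : ℕ) (p : List Bool) (b : Bool), upd n (enc n p) b = enc n (p ++ [b]) := by
    intro n p b
    by_cases h : ∃ x ∈ G n, p <+: x
    · rw [hupd, if_neg (henc1 h), hdecenc h]
    · have h' : ¬ ∃ x ∈ G n, p ++ [b] <+: x :=
        fun ⟨x, hx, hpx⟩ => h ⟨x, hx, (List.prefix_append p [b]).trans hpx⟩
      rw [hupd, if_pos (henc0 h), henc0 h']
  have hfold : ∀ (n : ℕ) (x p : List Bool), x.foldl (upd n) (enc n p) = enc n (p ++ x) := by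
    intro n x
    induction x with
    | nil => intro p; simp
    | cons b x ih =>
      intro p; rw [List.foldl_cons, hupdenc, ih, List.append_assoc, List.singleton_append]
  -- the space bound
  have budget : ∀ n t : ℕ, n ≤ t → n + 2 + (t + 1) * (8 * (n + t) + 10) ≤ t ^ 60 + 60 := by
    intro n t h
    have h1 : n + 2 + (t + 1) * (8 * (n + t) + 10) ≤ 16 * t ^ 2 + 27 * t + 12 := by nlinarith
    rcases Nat.lt_or_ge t 2 with ht | ht
    · interval_cases t <;> interval_cases n <;> norm_num
    · have h2 : 16 * t ^ 2 + 27 * t + 12 ≤ 33 * t ^ 2 := by nlinarith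
      have h3 : 33 * t ^ 2 ≤ t ^ 60 :=
        calc 33 * t ^ 2 ≤ 2 ^ 58 * t ^ 2 := by gcongr; norm_num
          _ ≤ t ^ 58 * t ^ 2 := by gcongr
          _ = t ^ 60 := by ring
      omega
  have hlen : ∀ (n : ℕ) (p : List Bool), (enc n p).length ≤ s n ^ 60 + 60 := by
    intro n p
    by_cases h : ∃ x ∈ G n, p <+: x
    · rw [henc, dif_pos h]
      obtain ⟨-, hCs, -⟩ := Classical.choose_spec ((hG n _).1 (Classical.choose_spec h).1)
      have hd := Kannan.length_desc_le_of_size_le _ hCs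
      have hb := budget n (s n) (hs n)
      simp only [List.length_cons, List.length_append, Kannan.length_bitsOf]
      omega
    · rw [henc0 h]; simp
  -- the algorithm (arity `⌊log₂ N⌋`; lengths that are not powers of two are rejected)
  obtain ⟨ini, hini⟩ : ∃ ini : ℕ → List Bool, ∀ N,
      ini N = if N = 2 ^ Nat.log 2 N then enc (Nat.log 2 N) [] else [] := ⟨_, fun _ => rfl⟩
  obtain ⟨up, hup⟩ : ∃ up : ℕ → List Bool → Bool → List Bool, ∀ N st b,
      up N st b = if N = 2 ^ Nat.log 2 N then upd (Nat.log 2 N) st b else [] :=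
    ⟨_, fun _ _ _ => rfl⟩
  obtain ⟨acc, hacc⟩ : ∃ acc : ℕ → List Bool → Bool, ∀ N st,
      acc N st = decide (N = 2 ^ Nat.log 2 N ∧ st ≠ [true]) := ⟨_, fun _ _ => rfl⟩
  have hspace :
      (⟨ini, up, acc⟩ : StreamingAlgorithm).HasSpace (fun N => s (Nat.log 2 N) ^ 60 + 60) := by
    refine fun N => ⟨?_, fun st b _ => ?_⟩
    · show (ini N).length ≤ _
      rw [hini]; split_ifs <;> [exact hlen _ _; simp]
    · show (up N st b).length ≤ _
      rw [hup]; split_ifs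
      · rw [hupd]; split_ifs <;> [simp; exact hlen _ _]
      · simp
  have hdecides : (⟨ini, up, acc⟩ : StreamingAlgorithm).Decides (MCSPSize s) := by
    intro x
    show acc x.length (x.foldl (up x.length) (ini x.length)) = true ↔ x ∈ MCSPSize s
    rw [hacc, decide_eq_true_iff]
    by_cases hx : x.length = 2 ^ Nat.log 2 x.length
    · have hu : up x.length = upd (Nat.log 2 x.length) := by funext st b; rw [hup, if_pos hx]
      rw [hu, hini, if_pos hx, hfold, List.nil_append]
      constructor
      · rintro ⟨-, hne⟩
        have hl : ∃ y ∈ G (Nat.log 2 x.length), x <+: y := by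
          by_contra hl; exact hne (henc0 hl)
        obtain ⟨y, hy, hxy⟩ := hl
        obtain rfl : x = y := hxy.eq_of_length (by rw [hx, (hGmem.1 hy).2])
        exact (hGmem.1 hy).1
      · intro hmem
        exact ⟨hx, henc1 ⟨x, hGmem.2 ⟨hmem, hx⟩, List.prefix_rfl⟩⟩
    · constructor
      · exact fun h => absurd h.1 hx
      · rintro ⟨m, f, rfl, -⟩
        exact (hx (by rw [length_truthTable, Nat.log_pow (by norm_num)])).elim
  exact hno 60 ⟨⟨ini, up, acc⟩, hspace, updFree _ _ _ hspace
    (fun _ => (Nat.le_add_left 1 59).trans (Nat.le_add_left 60 _)), hdecides⟩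

end Summit.PneNP.PneNP.Theorems
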